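import Mathlib
import Summits.Ventures.PercRepro2.CutFarOA3Theorem

/-!
# The marks `o` and `a₃` behind an unmarked cut vertex, III: the raw sorting identity and the far counts (blind cell
PercRepro2, p3 g3, 2026-08-25; `proofs/P3-BRIDGE.md` §11.9 (c))

The RAW SORTING IDENTITY `typedCount F z τ K₃ = (Σ_{24} cL · cH) · (inert)` over the `o`-copy and
the exact `a₃`-pattern (`typedCount_eq_cutFarOA3_raw`, from `K3_eq_cutFarOA3` and
`typedCount_mul_three`); the far counts are orbit-invariant (`far_swap12/13/23`) and the `w`-patterns
add up to `D = #{o ∈ C_w(c), a₃ ∉ C_w(c)}` and `E = #{o, a₃ ∈ C_w(c)}` (`far_sums`).  Own work;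
standard axioms.
-/

namespace Summit.Ventures.PercRepro2

open UnionCluster

namespace CovForm

namespace RootBridge

open OneTyped TypedA3 Untouched TypedFactor Separated

section Count

open Classical

variable {V : Type*} {E : Type*} [Fintype E] [DecidableEq E] {R : Type*} [Field R]
  [LinearOrder R] [IsStrictOrderedRing R]
variable (ends : E → Sym2 V) (o a₁ a₂ a₃ b c : V)

omit [LinearOrder R] [IsStrictOrderedRing R] in
/-- **The raw sorting identity**: `typedCount F z τ K₃ = (Σ_{24} cL · cH) · (inert count)`. -/
theorem typedCount_eq_cutFarOA3_raw {VL VH : Set V} (F : Finset E) (z : Config E) (τ : E → ℕ)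
    (h : CutFarOA3 ends o a₁ a₂ a₃ b c VL VH F z) :
    typedCount F z τ (K3 ends o a₁ a₂ a₃ b : Config E → Config E → Config E → R) =
      (      typedCount (sideF ends VL F) z τ (lKOA ends o a₃ c VL true false false false false false) *
          typedCount (sideF ends VH F) z τ (hKOA ends a₁ a₂ b c VH true false false false false false) +
      typedCount (sideF ends VL F) z τ (lKOA ends o a₃ c VL true false false true false false) *
          typedCount (sideF ends VH F) z τ (hKOA ends a₁ a₂ b c VH true false false true false false) +
      typedCount (sideF ends VL F) z τ (lKOA ends o a₃ c VL true false false false true false) *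
          typedCount (sideF ends VH F) z τ (hKOA ends a₁ a₂ b c VH true false false false true false) +
      typedCount (sideF ends VL F) z τ (lKOA ends o a₃ c VL true false false false false true) *
          typedCount (sideF ends VH F) z τ (hKOA ends a₁ a₂ b c VH true false false false false true) +
      typedCount (sideF ends VL F) z τ (lKOA ends o a₃ c VL true false false true true false) *
          typedCount (sideF ends VH F) z τ (hKOA ends a₁ a₂ b c VH true false false true true false) +
      typedCount (sideF ends VL F) z τ (lKOA ends o a₃ c VL true false false true false true) *
          typedCount (sideF ends VH F) z τ (hKOA ends a₁ a₂ b c VH true false false true false true) +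
      typedCount (sideF ends VL F) z τ (lKOA ends o a₃ c VL true false false false true true) *
          typedCount (sideF ends VH F) z τ (hKOA ends a₁ a₂ b c VH true false false false true true) +
      typedCount (sideF ends VL F) z τ (lKOA ends o a₃ c VL true false false true true true) *
          typedCount (sideF ends VH F) z τ (hKOA ends a₁ a₂ b c VH true false false true true true) +
      typedCount (sideF ends VL F) z τ (lKOA ends o a₃ c VL false true false false false false) *
          typedCount (sideF ends VH F) z τ (hKOA ends a₁ a₂ b c VH false true false false false false) +
      typedCount (sideF ends VL F) z τ (lKOA ends o a₃ c VL false true false true false false) *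
          typedCount (sideF ends VH F) z τ (hKOA ends a₁ a₂ b c VH false true false true false false) +
      typedCount (sideF ends VL F) z τ (lKOA ends o a₃ c VL false true false false true false) *
          typedCount (sideF ends VH F) z τ (hKOA ends a₁ a₂ b c VH false true false false true false) +
      typedCount (sideF ends VL F) z τ (lKOA ends o a₃ c VL false true false false false true) *
          typedCount (sideF ends VH F) z τ (hKOA ends a₁ a₂ b c VH false true false false false true) +
      typedCount (sideF ends VL F) z τ (lKOA ends o a₃ c VL false true false true true false) *
          typedCount (sideF ends VH F) z τ (hKOA ends a₁ a₂ b c VH false true false true true false) +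
      typedCount (sideF ends VL F) z τ (lKOA ends o a₃ c VL false true false true false true) *
          typedCount (sideF ends VH F) z τ (hKOA ends a₁ a₂ b c VH false true false true false true) +
      typedCount (sideF ends VL F) z τ (lKOA ends o a₃ c VL false true false false true true) *
          typedCount (sideF ends VH F) z τ (hKOA ends a₁ a₂ b c VH false true false false true true) +
      typedCount (sideF ends VL F) z τ (lKOA ends o a₃ c VL false true false true true true) *
          typedCount (sideF ends VH F) z τ (hKOA ends a₁ a₂ b c VH false true false true true true) +
      typedCount (sideF ends VL F) z τ (lKOA ends o a₃ c VL false false true false false false) *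
          typedCount (sideF ends VH F) z τ (hKOA ends a₁ a₂ b c VH false false true false false false) +
      typedCount (sideF ends VL F) z τ (lKOA ends o a₃ c VL false false true true false false) *
          typedCount (sideF ends VH F) z τ (hKOA ends a₁ a₂ b c VH false false true true false false) +
      typedCount (sideF ends VL F) z τ (lKOA ends o a₃ c VL false false true false true false) *
          typedCount (sideF ends VH F) z τ (hKOA ends a₁ a₂ b c VH false false true false true false) +
      typedCount (sideF ends VL F) z τ (lKOA ends o a₃ c VL false false true false false true) *
          typedCount (sideF ends VH F) z τ (hKOA ends a₁ a₂ b c VH false false true false false true) +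
      typedCount (sideF ends VL F) z τ (lKOA ends o a₃ c VL false false true true true false) *
          typedCount (sideF ends VH F) z τ (hKOA ends a₁ a₂ b c VH false false true true true false) +
      typedCount (sideF ends VL F) z τ (lKOA ends o a₃ c VL false false true true false true) *
          typedCount (sideF ends VH F) z τ (hKOA ends a₁ a₂ b c VH false false true true false true) +
      typedCount (sideF ends VL F) z τ (lKOA ends o a₃ c VL false false true false true true) *
          typedCount (sideF ends VH F) z τ (hKOA ends a₁ a₂ b c VH false false true false true true) +
      typedCount (sideF ends VL F) z τ (lKOA ends o a₃ c VL false false true true true true) *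
          typedCount (sideF ends VH F) z τ (hKOA ends a₁ a₂ b c VH false false true true true true)) *
        typedCount (F \ (sideF ends VL F ∪ sideF ends VH F)) z τ (fun _ _ _ => (1 : R)) := by
  set A := sideF ends VL F with hA
  set B := sideF ends VH F with hB
  set C := F \ (A ∪ B) with hC
  have hAF : A ⊆ F := Finset.filter_subset _ _
  have hBF : B ⊆ F := Finset.filter_subset _ _
  have hAB : Disjoint A B := by
    rw [Finset.disjoint_left]
    intro e heA heB
    simp only [hA, hB, sideF, Finset.mem_filter] at heA heB
    exact h.noloop e heA.1 ⟨heA.2, heB.2⟩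
  have hABF : A ∪ B ⊆ F := Finset.union_subset hAF hBF
  have hAC : Disjoint A C := Finset.disjoint_of_subset_left Finset.subset_union_left Finset.disjoint_sdiff
  have hBC : Disjoint B C := Finset.disjoint_of_subset_left Finset.subset_union_right Finset.disjoint_sdiff
  have hF : A ∪ B ∪ C = F := Finset.union_sdiff_of_subset hABF
  have hker : typedCount F z τ (K3 ends o a₁ a₂ a₃ b : Config E → Config E → Config E → R) =
      typedCount F z τ (fun x y w =>
        lKOA ends o a₃ c VL true false false false false false (restr A z x) (restr A z y) (restr A z w) *
          hKOA ends a₁ a₂ b c VH true false false false false false (restr B z x) (restr B z y) (restr B z w) +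
        lKOA ends o a₃ c VL true false false true false false (restr A z x) (restr A z y) (restr A z w) *
          hKOA ends a₁ a₂ b c VH true false false true false false (restr B z x) (restr B z y) (restr B z w) +
        lKOA ends o a₃ c VL true false false false true false (restr A z x) (restr A z y) (restr A z w) *
          hKOA ends a₁ a₂ b c VH true false false false true false (restr B z x) (restr B z y) (restr B z w) +
        lKOA ends o a₃ c VL true false false false false true (restr A z x) (restr A z y) (restr A z w) *
          hKOA ends a₁ a₂ b c VH true false false false false true (restr B z x) (restr B z y) (restr B z w) +
        lKOA ends o a₃ c VL true false false true true false (restr A z x) (restr A z y) (restr A z w) *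
          hKOA ends a₁ a₂ b c VH true false false true true false (restr B z x) (restr B z y) (restr B z w) +
        lKOA ends o a₃ c VL true false false true false true (restr A z x) (restr A z y) (restr A z w) *
          hKOA ends a₁ a₂ b c VH true false false true false true (restr B z x) (restr B z y) (restr B z w) +
        lKOA ends o a₃ c VL true false false false true true (restr A z x) (restr A z y) (restr A z w) *
          hKOA ends a₁ a₂ b c VH true false false false true true (restr B z x) (restr B z y) (restr B z w) +
        lKOA ends o a₃ c VL true false false true true true (restr A z x) (restr A z y) (restr A z w) *
          hKOA ends a₁ a₂ b c VH true false false true true true (restr B z x) (restr B z y) (restr B z w) +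
        lKOA ends o a₃ c VL false true false false false false (restr A z x) (restr A z y) (restr A z w) *
          hKOA ends a₁ a₂ b c VH false true false false false false (restr B z x) (restr B z y) (restr B z w) +
        lKOA ends o a₃ c VL false true false true false false (restr A z x) (restr A z y) (restr A z w) *
          hKOA ends a₁ a₂ b c VH false true false true false false (restr B z x) (restr B z y) (restr B z w) +
        lKOA ends o a₃ c VL false true false false true false (restr A z x) (restr A z y) (restr A z w) *
          hKOA ends a₁ a₂ b c VH false true false false true false (restr B z x) (restr B z y) (restr B z w) +
        lKOA ends o a₃ c VL false true false false false true (restr A z x) (restr A z y) (restr A z w) *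
          hKOA ends a₁ a₂ b c VH false true false false false true (restr B z x) (restr B z y) (restr B z w) +
        lKOA ends o a₃ c VL false true false true true false (restr A z x) (restr A z y) (restr A z w) *
          hKOA ends a₁ a₂ b c VH false true false true true false (restr B z x) (restr B z y) (restr B z w) +
        lKOA ends o a₃ c VL false true false true false true (restr A z x) (restr A z y) (restr A z w) *
          hKOA ends a₁ a₂ b c VH false true false true false true (restr B z x) (restr B z y) (restr B z w) +
        lKOA ends o a₃ c VL false true false false true true (restr A z x) (restr A z y) (restr A z w) *
          hKOA ends a₁ a₂ b c VH false true false false true true (restr B z x) (restr B z y) (restr B z w) +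
        lKOA ends o a₃ c VL false true false true true true (restr A z x) (restr A z y) (restr A z w) *
          hKOA ends a₁ a₂ b c VH false true false true true true (restr B z x) (restr B z y) (restr B z w) +
        lKOA ends o a₃ c VL false false true false false false (restr A z x) (restr A z y) (restr A z w) *
          hKOA ends a₁ a₂ b c VH false false true false false false (restr B z x) (restr B z y) (restr B z w) +
        lKOA ends o a₃ c VL false false true true false false (restr A z x) (restr A z y) (restr A z w) *
          hKOA ends a₁ a₂ b c VH false false true true false false (restr B z x) (restr B z y) (restr B z w) +
        lKOA ends o a₃ c VL false false true false true false (restr A z x) (restr A z y) (restr A z w) *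
          hKOA ends a₁ a₂ b c VH false false true false true false (restr B z x) (restr B z y) (restr B z w) +
        lKOA ends o a₃ c VL false false true false false true (restr A z x) (restr A z y) (restr A z w) *
          hKOA ends a₁ a₂ b c VH false false true false false true (restr B z x) (restr B z y) (restr B z w) +
        lKOA ends o a₃ c VL false false true true true false (restr A z x) (restr A z y) (restr A z w) *
          hKOA ends a₁ a₂ b c VH false false true true true false (restr B z x) (restr B z y) (restr B z w) +
        lKOA ends o a₃ c VL false false true true false true (restr A z x) (restr A z y) (restr A z w) *
          hKOA ends a₁ a₂ b c VH false false true true false true (restr B z x) (restr B z y) (restr B z w) +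
        lKOA ends o a₃ c VL false false true false true true (restr A z x) (restr A z y) (restr A z w) *
          hKOA ends a₁ a₂ b c VH false false true false true true (restr B z x) (restr B z y) (restr B z w) +
        lKOA ends o a₃ c VL false false true true true true (restr A z x) (restr A z y) (restr A z w) *
          hKOA ends a₁ a₂ b c VH false false true true true true (restr B z x) (restr B z y) (restr B z w)) := by
    refine typedCount_congr_on_support F z τ fun x y w hc _ => ?_
    exact K3_eq_cutFarOA3 ends o a₁ a₂ a₃ b c h (fun e he => (hc e he).1)
      (fun e he => (hc e he).2.1) (fun e he => (hc e he).2.2)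
  rw [hker, typedCount_add', typedCount_add', typedCount_add', typedCount_add', typedCount_add', typedCount_add', typedCount_add', typedCount_add', typedCount_add', typedCount_add', typedCount_add', typedCount_add', typedCount_add', typedCount_add', typedCount_add', typedCount_add', typedCount_add', typedCount_add', typedCount_add', typedCount_add', typedCount_add', typedCount_add', typedCount_add']
  have hm : ∀ ox oy ow sx sy sw : Bool, typedCount (A ∪ B ∪ C) z τ (fun x y w =>
      lKOA ends o a₃ c VL ox oy ow sx sy sw (restr A z x) (restr A z y) (restr A z w) *
        hKOA ends a₁ a₂ b c VH ox oy ow sx sy sw (restr B z x) (restr B z y) (restr B z w)) =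
      typedCount A z τ (lKOA ends o a₃ c VL ox oy ow sx sy sw) *
        typedCount B z τ (hKOA ends a₁ a₂ b c VH ox oy ow sx sy sw) *
        typedCount C z τ (fun _ _ _ => (1 : R)) := fun ox oy ow sx sy sw =>
    typedCount_mul_three A B C hAB hAC hBC z τ (lKOA ends o a₃ c VL ox oy ow sx sy sw)
      (hKOA ends a₁ a₂ b c VH ox oy ow sx sy sw : Config E → Config E → Config E → R)
  rw [hF] at hm
  rw [hm true false false false false false, hm true false false true false false, hm true false false false true false, hm true false false false false true, hm true false false true true false, hm true false false true false true, hm true false false false true true, hm true false false true true true, hm false true false false false false, hm false true false true false false, hm false true false false true false, hm false true false false false true, hm false true false true true false, hm false true false true false true, hm false true false false true true, hm false true false true true true, hm false false true false false false, hm false false true true false false, hm false false true false true false, hm false false true false false true, hm false false true true true false, hm false false true true false true, hm false false true false true true, hm false false true true true true]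
  ring

omit [LinearOrder R] [IsStrictOrderedRing R] in
/-- The far counts are invariant under swapping the first two copies of the pattern. -/
lemma far_swap12 (VL : Set V) (A : Finset E) (z : Config E) (τ : E → ℕ) (ox oy ow sx sy sw : Bool) :
    typedCount A z τ (lKOA ends o a₃ c VL ox oy ow sx sy sw : Config E → Config E → Config E → R) =
      typedCount A z τ (lKOA ends o a₃ c VL oy ox ow sy sx sw) := by
  rw [← typedCount_swap12 A z τ (lKOA ends o a₃ c VL oy ox ow sy sx sw)]
  exact typedCount_congr' _ _ _ _ _ fun x y w => by unfold lKOA exactOB; push_cast; ring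

omit [LinearOrder R] [IsStrictOrderedRing R] in
/-- The far counts are invariant under swapping the last two copies of the pattern. -/
lemma far_swap23 (VL : Set V) (A : Finset E) (z : Config E) (τ : E → ℕ)
    (hτ : ∀ e ∈ A, τ e = 1 ∨ τ e = 2) (ox oy ow sx sy sw : Bool) :
    typedCount A z τ (lKOA ends o a₃ c VL ox oy ow sx sy sw : Config E → Config E → Config E → R) =
      typedCount A z τ (lKOA ends o a₃ c VL ox ow oy sx sw sy) := by
  rw [← typedCount_swap23 A z τ hτ (lKOA ends o a₃ c VL ox ow oy sx sw sy)]
  exact typedCount_congr' _ _ _ _ _ fun x y w => by unfold lKOA exactOB; push_cast; ring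

omit [LinearOrder R] [IsStrictOrderedRing R] in
/-- The far counts are invariant under swapping the outer copies of the pattern. -/
lemma far_swap13 (VL : Set V) (A : Finset E) (z : Config E) (τ : E → ℕ)
    (hτ : ∀ e ∈ A, τ e = 1 ∨ τ e = 2) (ox oy ow sx sy sw : Bool) :
    typedCount A z τ (lKOA ends o a₃ c VL ox oy ow sx sy sw : Config E → Config E → Config E → R) =
      typedCount A z τ (lKOA ends o a₃ c VL ow oy ox sw sy sx) := by
  rw [← typedCount_swap13 A z τ hτ (lKOA ends o a₃ c VL ow oy ox sw sy sx)]
  exact typedCount_congr' _ _ _ _ _ fun x y w => by unfold lKOA exactOB; push_cast; ring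

/-- The far count `D = #{o ∈ C_w(c), a₃ ∉ C_w(c)}`. -/
noncomputable def farD (VL : Set V) (A : Finset E) (z : Config E) (τ : E → ℕ) : R :=
  typedCount A z τ (fun _ _ w => ((indOB (gOA ends c VL o w) * (1 - indOB (gOA ends c VL a₃ w)) : ℤ) : R))

/-- The far count `E = #{o ∈ C_w(c), a₃ ∈ C_w(c)}`. -/
noncomputable def farE (VL : Set V) (A : Finset E) (z : Config E) (τ : E → ℕ) : R :=
  typedCount A z τ (fun _ _ w => ((indOB (gOA ends c VL o w) * indOB (gOA ends c VL a₃ w) : ℤ) : R))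

omit [Fintype E] [DecidableEq E] [LinearOrder R] [IsStrictOrderedRing R] in
/-- The four exact patterns without the third copy sum to `1 − g₃(w)`. -/
lemma exact_sum_out (gx gy gw : Bool) :
    exactOB false false false gx gy gw + exactOB true false false gx gy gw +
      exactOB false true false gx gy gw + exactOB true true false gx gy gw = 1 - indOB gw := by
  cases gx <;> cases gy <;> cases gw <;> simp [exactOB, indOB]

omit [Fintype E] [DecidableEq E] [LinearOrder R] [IsStrictOrderedRing R] in
/-- The four exact patterns with the third copy sum to `g₃(w)`. -/
lemma exact_sum_in (gx gy gw : Bool) :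
    exactOB false false true gx gy gw + exactOB true false true gx gy gw +
      exactOB false true true gx gy gw + exactOB true true true gx gy gw = indOB gw := by
  cases gx <;> cases gy <;> cases gw <;> simp [exactOB, indOB]

omit [LinearOrder R] [IsStrictOrderedRing R] in
/-- **The far sums**: the `w`-patterns without `a₃` at `w` add up to `D`, those with `a₃` at `w` to `E`. -/
lemma far_sums (VL : Set V) (A : Finset E) (z : Config E) (τ : E → ℕ) :
    typedCount A z τ (lKOA ends o a₃ c VL false false true false false false : Config E → Config E → Config E → R) +
        typedCount A z τ (lKOA ends o a₃ c VL false false true true false false) +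
        typedCount A z τ (lKOA ends o a₃ c VL false false true false true false) +
        typedCount A z τ (lKOA ends o a₃ c VL false false true true true false) =
      farD (R := R) ends o a₃ c VL A z τ ∧
    typedCount A z τ (lKOA ends o a₃ c VL false false true false false true : Config E → Config E → Config E → R) +
        typedCount A z τ (lKOA ends o a₃ c VL false false true true false true) +
        typedCount A z τ (lKOA ends o a₃ c VL false false true false true true) +
        typedCount A z τ (lKOA ends o a₃ c VL false false true true true true) =
      farE (R := R) ends o a₃ c VL A z τ := by
  constructor
  · rw [← typedCount_add', ← typedCount_add', ← typedCount_add']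
    unfold farD
    refine typedCount_congr' _ _ _ _ _ fun x y w => ?_
    unfold lKOA
    have e := exact_sum_out (gOA ends c VL a₃ x) (gOA ends c VL a₃ y) (gOA ends c VL a₃ w)
    have e' := congrArg (fun n : ℤ => (n : R)) e
    push_cast at e' ⊢
    simp only [ofx_true, ofx_false]
    push_cast
    linear_combination ((indOB (gOA ends c VL o w) : ℤ) : R) * e'
  · rw [← typedCount_add', ← typedCount_add', ← typedCount_add']
    unfold farE
    refine typedCount_congr' _ _ _ _ _ fun x y w => ?_
    unfold lKOA
    have e := exact_sum_in (gOA ends c VL a₃ x) (gOA ends c VL a₃ y) (gOA ends c VL a₃ w)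
    have e' := congrArg (fun n : ℤ => (n : R)) e
    push_cast at e' ⊢
    simp only [ofx_true, ofx_false]
    push_cast
    linear_combination ((indOB (gOA ends c VL o w) : ℤ) : R) * e'

end Count

end RootBridge

end CovForm

end Summit.Ventures.PercRepro2
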